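import Literature.NumberTheory.Transcendental.HyperlogarithmsAtOneFamilies
import HarnessLib

/-!
# Hyperlogarithms on `(0,1)`, XII: the cubical family and the KZ structure in the parameter

Twelfth layer of the analytic road to `GenusZeroPeriodsMZV` (Brown 2009). In the cubical
coordinates `x_i = t_i/t_{i+1}` of the moduli space `𝔐_{0,ℓ+3}` the letters of the alphabet seen by
the first variable are `0`, `1` and the MOVING points `1/(y π_c) > 1` (`y` the next variable, `π_c`
products of the remaining ones). This file proves that the regularised values at `1` of the
hyperlogarithms of this family are themselves hyperlogarithms IN THE PARAMETER `y`, for the next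
alphabet `{0} ∪ {1/π_c}`, with multiple zeta values as coefficients — Brown's "restriction of a
regularised hyperlogarithm to a boundary divisor is a hyperlogarithm in the remaining coordinates
with MZV coefficients" (§6.3, Thm 6.25) in the form needed for the fibration argument of §8.3.

* `Hyperlog.hlogAt1_le_prod_mul_hlogAt1`: scaled comparison of alphabets; `Hyperlog.hlogAt1_σf_le`,
  `Hyperlog.tendsto_hlogAt1_σf` (**T2**): `L_v(1; σ_y) ≤ 2y · L_v(1; {0,1,2}) → 0` as `y → 0⁺` when
  `v` has a moving letter (domination `1/(σ-t) ≤ (2/σ)/(2-t)` for `σ ≥ 2`).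
* `Hyperlog.σf`, `Hyperlog.σf'`: the family and its derivative; all hypotheses of layers X–XI
  (`σf_adm`, `σf_injective`, `hasDerivAt_σf`, …); the PAIRING TABLE `lam_σf_eq`, `lamBase_σf_eq`,
  `lamEnd1_σf_eq`: every pairing `Λ` of Goncharov's formula is `ℚ`-linear in `1/y` and
  `1/(y - 1/π_c)` (key relation `σ' = -σ/y`).
* `Hyperlog.evalE`, `Hyperlog.primE`, `Hyperlog.hasDerivAt_evalE_primE`: expansions
  `Σ_U E_U L_U(y; τ)` in the regularised hyperlogarithms of the level-2 alphabet and their primitives.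
* `Hyperlog.exists_expansion`, `Hyperlog.hlogAt1_σf_eq_evalE` (**T4**): for a doubly regular word
  `v`, `L_v(1; σ_y) = Σ_U (E_v)_U L_U(y; τ)` on `(0,1)` — by induction on `|v|`: the derivative in `y`
  (layer XI) is the deletion sum, a combination of the densities of `τ` times values of shorter
  words (`hasDerivAt_evalE_DtopE`), so `L_v(1;σ_y)` minus the primitive expansion is constant.
* `Hyperlog.exists_good_expansion`, `Hyperlog.hlogAt1_σf_eq_evalE_good` (**T4 with coefficients**):
  the entries satisfy `(E_v)_U ∈ 𝒵_{≤ |v|-|U|}` (`GoodE`), the constant being identified through the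
  regularised values at `y → 0⁺` (`hasRegValue_evalE`: `Reg Σ E_U L_U = E_∅`; `hasRegValue_hlogAt1_σf`:
  `Reg L_v(1;σ_y) = 0` if `v` has a moving letter (T2), `= ζ(v)` otherwise).

No named fact is introduced.

## References

* F. C. S. Brown, *Multiple zeta values and periods of moduli spaces `𝔐̄_{0,n}`*, Ann. Sci. Éc.
  Norm. Supér. (4) 42 (2009), 371–489, §5.3, §6.3 (Thm 6.25), §8.3. doi:10.24033/asens.2099.
  [BrownENS2009]
* A. B. Goncharov, *Multiple polylogarithms, cyclotomy and modular complexes*, Math. Res. Lett.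
  5 (1998), 497–516, Thm 2.1.
-/

noncomputable section

open MeasureTheory intervalIntegral Set Filter
open scoped BigOperators Topology

namespace Literature.NumberTheory.Transcendental

namespace Hyperlog

variable {α : Type*}

/-! ### Comparison of alphabets and large letters -/

section Compare

/-- Scaling the densities scales the iterated integral by the product of the scalars. [folklore] -/
theorem iterInt_scale (c : α → ℝ) (f : α → ℝ → ℝ) : ∀ (w : List α) (a b : ℝ),
    iterInt (fun x t => c x * f x t) w a b = (w.map c).prod * iterInt f w a b
  | [], a, b => by simp
  | x :: w, a, b => by
    rw [iterInt_cons, iterInt_cons, List.map_cons, List.prod_cons]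
    have : (fun t => c x * f x t * iterInt (fun x t => c x * f x t) w a t) =
        fun t => (c x * (w.map c).prod) * (f x t * iterInt f w a t) := by
      funext t; rw [iterInt_scale c f w a t]; ring
    rw [this, intervalIntegral.integral_const_mul]

variable {σ σ₂ : α → ℝ} (hσ : ∀ c, σ c = 0 ∨ 1 ≤ σ c) (hσ₂ : ∀ c, σ₂ c = 0 ∨ 1 ≤ σ₂ c)
include hσ hσ₂

/-- **Scaled comparison of hyperlogarithms of two alphabets on the same letters**: if
`1/|t-σ_c| ≤ λ_c/|t-σ₂_c|` on `(0,1)` with `λ_c > 0`, then `L^σ_v(b) ≤ (∏_{c∈v} λ_c) L^{σ₂}_v(b)`.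
[folklore] -/
theorem hlog_le_prod_mul_hlog (lam : α → ℝ) (hlam : ∀ c, 0 < lam c)
    (hdom : ∀ c, ∀ t ∈ Ioo (0 : ℝ) 1, pden σ c t ≤ lam c * pden σ₂ c t)
    {v : List α} (hv : IsReg σ₂ v) {b : ℝ} (hb : b ∈ Ioo (0 : ℝ) 1) :
    hlog σ v b ≤ (v.map lam).prod * hlog σ₂ v b := by
  have hprod : 0 ≤ (v.map lam).prod := (List.prod_pos (fun x hx => by
    obtain ⟨c, -, rfl⟩ := List.mem_map.1 hx; exact hlam c)).le
  unfold hlog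
  refine csSup_le ((nonempty_Ioo.mpr hb.1).image _) ?_
  rintro _ ⟨ε, hε, rfl⟩
  have hε1 : ε ∈ Ioo (0 : ℝ) 1 := ⟨hε.1, hε.2.trans hb.2⟩
  have hcmp := iterInt_mono_densities (f := pden σ) (g := fun c t => lam c * pden σ₂ c t) id
    KZ3.isOpen_Ioo01 KZ3.ordConnected_Ioo01 (continuousOn_pden hσ)
    (fun c => (continuousOn_const).mul (continuousOn_pden hσ₂ c)) pden_nonneg
    (fun c t ht => hdom c t ht) hε1 v hb hε.2.le
  rw [List.map_id, iterInt_scale] at hcmp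
  refine hcmp.trans (mul_le_mul_of_nonneg_left ?_ hprod)
  exact le_csSup (bddAbove_iterInt hσ₂ hv hb) ⟨ε, hε, rfl⟩

variable [Fintype α] [DecidableEq α]

/-- The same comparison for the values at `1`. [folklore] -/
theorem hlogAt1_le_prod_mul_hlogAt1 (lam : α → ℝ) (hlam : ∀ c, 0 < lam c)
    (hdom : ∀ c, ∀ t ∈ Ioo (0 : ℝ) 1, pden σ c t ≤ lam c * pden σ₂ c t)
    {v : List α} (hv : IsReg σ₂ v) (htop : IsTopReg σ₂ v) :
    hlogAt1 σ v ≤ (v.map lam).prod * hlogAt1 σ₂ v := by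
  have hprod : 0 ≤ (v.map lam).prod := (List.prod_pos (fun x hx => by
    obtain ⟨c, -, rfl⟩ := List.mem_map.1 hx; exact hlam c)).le
  unfold hlogAt1
  refine csSup_le ((nonempty_Ioo.mpr (by norm_num : (1 / 2 : ℝ) < 1)).image _) ?_
  rintro _ ⟨b, hb, rfl⟩
  have hb1 : b ∈ Ioo (0 : ℝ) 1 := ⟨by linarith [hb.1], hb.2⟩
  refine (hlog_le_prod_mul_hlog hσ hσ₂ lam hlam hdom hv hb1).trans (mul_le_mul_of_nonneg_left ?_ hprod)
  exact le_csSup (bddAbove_hlog hσ₂ hv htop) ⟨b, hb, rfl⟩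

end Compare

/-! ### The cubical one-parameter family `σ_y = {0, 1, 1/(y π_c)}` -/

section Cubical

/-- Letters of a level alphabet: `z` at `0`, `o` at `1`, and moving letters indexed by `M`. [folklore] -/
inductive Let (M : Type*)
  | z
  | o
  | mv (c : M)
  deriving DecidableEq

namespace Let

variable {M : Type*}

/-- `Let M ≃ Option (Option M)` (for finiteness). [folklore] -/
def equivOption : Let M ≃ Option (Option M) where
  toFun | z => none | o => some none | mv c => some (some c)
  invFun | none => z | some none => o | some (some c) => mv c
  left_inv x := by cases x <;> rfl
  right_inv x := by rcases x with _ | _ | _ <;> rfl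

/-- `Let M` is finite when `M` is. [folklore] -/
instance [Fintype M] : Fintype (Let M) := Fintype.ofEquiv _ equivOption.symm

end Let

open Let

variable {M : Type*} [Fintype M] [DecidableEq M] (π : M → ℝ)

/-- The family of alphabets `σ_y`: `z ↦ 0`, `o ↦ 1`, `c ↦ 1/(y π_c)`. [folklore] -/
def σf (y : ℝ) : Let M → ℝ
  | z => 0
  | o => 1
  | mv c => 1 / (y * π c)

/-- The `y`-derivative of the family: `∂_y (1/(y π_c)) = -1/(y² π_c)`. [folklore] -/
def σf' (y : ℝ) : Let M → ℝ
  | z => 0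
  | o => 0
  | mv c => -(1 / (y ^ 2 * π c))

/-- The comparison alphabet `z ↦ 0`, `o ↦ 1`, `c ↦ 2`. [folklore] -/
def σtwo : Let M → ℝ
  | z => 0
  | o => 1
  | mv _ => 2

/-- The scalars of the comparison: `1` for `z, o`, `2 y π_c = 2/σ_c` for the moving letters. [folklore] -/
def lamTwo (y : ℝ) : Let M → ℝ
  | z => 1
  | o => 1
  | mv c => 2 * (y * π c)

variable {π} (hπ : ∀ c, 0 < π c ∧ π c ≤ 1) (hπi : Function.Injective π)
include hπ

omit [Fintype M] [DecidableEq M] in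
/-- `0 < y π_c < 1` on `(0,1)`. [folklore] -/
theorem mul_pi_mem {y : ℝ} (hy : y ∈ Ioo (0 : ℝ) 1) (c : M) : 0 < y * π c ∧ y * π c < 1 := by
  obtain ⟨h0, h1⟩ := hπ c
  exact ⟨mul_pos hy.1 h0, by nlinarith [hy.2, hy.1]⟩

omit [Fintype M] [DecidableEq M] in
/-- The moving letters are `> 1` on `(0,1)`. [folklore] -/
theorem one_lt_σf_mv {y : ℝ} (hy : y ∈ Ioo (0 : ℝ) 1) (c : M) : 1 < σf π y (mv c) := by
  obtain ⟨h0, h1⟩ := mul_pi_mem hπ hy c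
  show 1 < 1 / (y * π c)
  rw [lt_div_iff₀ h0]; linarith

omit [Fintype M] [DecidableEq M] in
/-- The family is admissible. [folklore] -/
theorem σf_adm {y : ℝ} (hy : y ∈ Ioo (0 : ℝ) 1) : ∀ a, σf π y a = 0 ∨ 1 ≤ σf π y a
  | z => Or.inl rfl
  | o => Or.inr (le_of_eq rfl)
  | mv c => Or.inr (one_lt_σf_mv hπ hy c).le

omit [Fintype M] [DecidableEq M] hπ in
/-- The comparison alphabet is admissible. [folklore] -/
theorem σtwo_adm : ∀ a : Let M, σtwo a = 0 ∨ 1 ≤ σtwo a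
  | z => Or.inl rfl
  | o => Or.inr (le_of_eq rfl)
  | mv _ => Or.inr (by show (1 : ℝ) ≤ 2; norm_num)

omit [Fintype M] [DecidableEq M] in
/-- Letters at `0`: exactly `z`, for every parameter. [folklore] -/
theorem σf_eq_zero_iff {y : ℝ} (hy : y ∈ Ioo (0 : ℝ) 1) (a : Let M) : σf π y a = 0 ↔ a = z := by
  cases a with
  | z => simp [σf]
  | o => simp [σf]
  | mv c =>
    simp only [reduceCtorEq, iff_false]
    exact (zero_lt_one.trans (one_lt_σf_mv hπ hy c)).ne'

omit [Fintype M] [DecidableEq M] in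
/-- Letters at `1`: exactly `o`, for every parameter. [folklore] -/
theorem σf_eq_one_iff {y : ℝ} (hy : y ∈ Ioo (0 : ℝ) 1) (a : Let M) : σf π y a = 1 ↔ a = o := by
  cases a with
  | z => simp [σf]
  | o => simp [σf]
  | mv c => simp only [reduceCtorEq, iff_false]; exact ne_of_gt (one_lt_σf_mv hπ hy c)

omit [Fintype M] [DecidableEq M] in
include hπi in
/-- Distinct letters have distinct values. [folklore] -/
theorem σf_injective {y : ℝ} (hy : y ∈ Ioo (0 : ℝ) 1) : ∀ a a' : Let M, σf π y a = σf π y a' → a = a' := by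
  intro a a' h
  cases a with
  | z => exact ((σf_eq_zero_iff hπ hy a').1 h.symm).symm
  | o => exact ((σf_eq_one_iff hπ hy a').1 h.symm).symm
  | mv c =>
    cases a' with
    | z => exact absurd ((σf_eq_zero_iff hπ hy (mv c)).1 h) (by simp)
    | o => exact absurd ((σf_eq_one_iff hπ hy (mv c)).1 h) (by simp)
    | mv c' =>
      simp only [σf] at h
      have h1 := (mul_pi_mem hπ hy c).1
      have h2 := (mul_pi_mem hπ hy c').1
      rw [div_eq_div_iff h1.ne' h2.ne', one_mul, one_mul] at h
      have : π c = π c' := (mul_left_cancel₀ hy.1.ne' h).symm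
      rw [hπi this]

omit [Fintype M] [DecidableEq M] in
/-- The derivative of the family. [folklore] -/
theorem hasDerivAt_σf {y : ℝ} (hy : y ∈ Ioo (0 : ℝ) 1) : ∀ a, HasDerivAt (fun y => σf π y a) (σf' π y a) y
  | z => by simpa [σf, σf'] using hasDerivAt_const y (0 : ℝ)
  | o => by simpa [σf, σf'] using hasDerivAt_const y (1 : ℝ)
  | mv c => by
    have h0 := (hπ c).1
    have hy0 : y ≠ 0 := hy.1.ne'
    show HasDerivAt (fun y => 1 / (y * π c)) (-(1 / (y ^ 2 * π c))) y
    have h := ((hasDerivAt_id y).mul_const (π c)).inv (mul_ne_zero hy0 h0.ne')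
    simp only [one_div]
    refine h.congr_deriv ?_
    simp; field_simp

omit [Fintype M] [DecidableEq M] in
/-- Continuity of the derivative of the family on `(0,1)`. [folklore] -/
theorem continuousOn_σf' : ∀ a, ContinuousOn (fun y => σf' π y a) (Ioo 0 1)
  | z => by simpa [σf'] using continuousOn_const
  | o => by simpa [σf'] using continuousOn_const
  | mv c => by
    have h0 := (hπ c).1
    show ContinuousOn (fun y => -(1 / (y ^ 2 * π c))) (Ioo 0 1)
    refine ContinuousOn.neg (continuousOn_const.div (by fun_prop) fun y hy => ?_)
    exact mul_ne_zero (pow_ne_zero 2 hy.1.ne') h0.ne'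

omit [Fintype M] [DecidableEq M] in
/-- Regularity at `0` in the family: the last letter is not `z`. [folklore] -/
theorem isReg_σf_iff {y : ℝ} (hy : y ∈ Ioo (0 : ℝ) 1) (w : List (Let M)) :
    IsReg (σf π y) w ↔ ∀ h : w ≠ [], w.getLast h ≠ z := by
  simp only [IsReg, ne_eq, σf_eq_zero_iff hπ hy]

omit [Fintype M] [DecidableEq M] in
/-- Regularity at `1` in the family: the head is not `o`. [folklore] -/
theorem isTopReg_σf_iff {y : ℝ} (hy : y ∈ Ioo (0 : ℝ) 1) (w : List (Let M)) :
    IsTopReg (σf π y) w ↔ ∀ h : w ≠ [], w.head h ≠ o := by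
  simp only [IsTopReg, ne_eq, σf_eq_one_iff hπ hy]

omit [Fintype M] [DecidableEq M] hπ in
/-- Regularity at `0` for the comparison alphabet. [folklore] -/
theorem isReg_σtwo_iff (w : List (Let M)) : IsReg σtwo w ↔ ∀ h : w ≠ [], w.getLast h ≠ z := by
  have : ∀ a : Let M, σtwo a = 0 ↔ a = z := fun a => by cases a <;> simp [σtwo]
  simp only [IsReg, ne_eq, this]

omit [Fintype M] [DecidableEq M] hπ in
/-- Regularity at `1` for the comparison alphabet. [folklore] -/
theorem isTopReg_σtwo_iff (w : List (Let M)) : IsTopReg σtwo w ↔ ∀ h : w ≠ [], w.head h ≠ o := by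
  have : ∀ a : Let M, σtwo a = 1 ↔ a = o := fun a => by
    cases a <;> simp [σtwo]
  simp only [IsTopReg, ne_eq, this]

omit [Fintype M] [DecidableEq M] in
/-- **Domination by the comparison alphabet** for `y ≤ 1/2` (so that all `σ_c ≥ 2`):
`1/(σ_c - t) ≤ (2/σ_c) · 1/(2-t)`. [folklore] -/
theorem pden_σf_le {y : ℝ} (hy : y ∈ Ioo (0 : ℝ) 1) (hy2 : y ≤ 1 / 2) :
    ∀ a, ∀ t ∈ Ioo (0 : ℝ) 1, pden (σf π y) a t ≤ lamTwo π y a * pden σtwo a t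
  | z, t, ht => by simp [lamTwo, pden, σf, σtwo]
  | o, t, ht => by simp [lamTwo, pden, σf, σtwo]
  | mv c, t, ht => by
    obtain ⟨h0, h1⟩ := mul_pi_mem hπ hy c
    have hyp : y * π c ≤ 1 / 2 := by nlinarith [(hπ c).2, hy.1]
    have hσ2 : 2 ≤ 1 / (y * π c) := by rw [le_div_iff₀ h0]; linarith
    rw [pden_of_ne_zero (σf_adm hπ hy) (c := mv c) (zero_lt_one.trans (one_lt_σf_mv hπ hy c)).ne' ht.2,
      pden_of_ne_zero σtwo_adm (c := mv c) (by simp [σtwo]) ht.2]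
    simp only [σf, σtwo, lamTwo]
    have h2t : 0 < 2 - t := by linarith [ht.2]
    have hσt : 0 < 1 / (y * π c) - t := by linarith [ht.2]
    rw [div_le_iff₀ hσt]
    have heq : 2 * (y * π c) * (1 / (2 - t)) * (1 / (y * π c) - t) = 2 * (1 - y * π c * t) / (2 - t) := by
      have hne : y * π c ≠ 0 := h0.ne'
      have h3 : y * π c * (1 / (y * π c) - t) = 1 - y * π c * t := by
        rw [mul_sub, mul_one_div_cancel hne]
      calc 2 * (y * π c) * (1 / (2 - t)) * (1 / (y * π c) - t)
          = 2 * (y * π c * (1 / (y * π c) - t)) * (1 / (2 - t)) := by ring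
        _ = 2 * (1 - y * π c * t) / (2 - t) := by rw [h3]; ring
    rw [heq, le_div_iff₀ h2t]
    nlinarith [ht.1]

omit [Fintype M] [DecidableEq M] in
/-- The product of the scalars over a word with a moving letter is `≤ 2 y`. [folklore] -/
theorem prod_lamTwo_le {y : ℝ} (hy : y ∈ Ioo (0 : ℝ) 1) (hy2 : y ≤ 1 / 2) :
    ∀ (v : List (Let M)), (∃ c, mv c ∈ v) → (v.map (lamTwo π y)).prod ≤ 2 * y := by
  -- all scalars are in `(0,1]`, and a moving letter contributes `2 y π_c ≤ 2 y`
  have hle1 : ∀ a, lamTwo π y a ≤ 1 := by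
    intro a; cases a with
    | z => exact le_rfl
    | o => exact le_rfl
    | mv c => show 2 * (y * π c) ≤ 1; nlinarith [(hπ c).1, (hπ c).2, hy.1]
  have hpos : ∀ a, 0 < lamTwo π y a := by
    intro a; cases a with
    | z => exact one_pos
    | o => exact one_pos
    | mv c => show 0 < 2 * (y * π c); exact by nlinarith [(hπ c).1, hy.1]
  have hprod1 : ∀ w : List (Let M), (w.map (lamTwo π y)).prod ≤ 1 := by
    intro w
    induction w with
    | nil => simp
    | cons a w IH =>
      rw [List.map_cons, List.prod_cons]
      calc lamTwo π y a * (w.map (lamTwo π y)).prod ≤ 1 * 1 :=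
            mul_le_mul (hle1 a) IH ((List.prod_pos fun x hx => by
              obtain ⟨a, -, rfl⟩ := List.mem_map.1 hx; exact hpos a).le) zero_le_one
        _ = 1 := mul_one _
  intro v ⟨c, hc⟩
  induction v with
  | nil => simp at hc
  | cons a v IH =>
    rw [List.map_cons, List.prod_cons]
    rcases List.mem_cons.1 hc with rfl | hc'
    · calc lamTwo π y (mv c) * (v.map (lamTwo π y)).prod ≤ (2 * y) * 1 := by
            refine mul_le_mul ?_ (hprod1 v) ?_ (by linarith [hy.1])
            · show 2 * (y * π c) ≤ 2 * y; nlinarith [(hπ c).2, hy.1]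
            · exact (List.prod_pos fun x hx => by obtain ⟨a, -, rfl⟩ := List.mem_map.1 hx; exact hpos a).le
        _ = 2 * y := mul_one _
    · calc lamTwo π y a * (v.map (lamTwo π y)).prod ≤ 1 * (2 * y) :=
            mul_le_mul (hle1 a) (IH hc') ((List.prod_pos fun x hx => by
              obtain ⟨a, -, rfl⟩ := List.mem_map.1 hx; exact hpos a).le) zero_le_one
        _ = 2 * y := one_mul _

/-- **Theorem T2: values of words with a large letter are small.** For a doubly regular word `v`
containing a moving letter, `L_v(1; σ_y) ≤ 2y · L_v(1; {0,1,2}) → 0` as `y → 0⁺`. [folklore] -/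
theorem hlogAt1_σf_le {y : ℝ} (hy : y ∈ Ioo (0 : ℝ) 1) (hy2 : y ≤ 1 / 2) {v : List (Let M)}
    (hv : ∀ h : v ≠ [], v.getLast h ≠ z) (htop : ∀ h : v ≠ [], v.head h ≠ o) (hmv : ∃ c, mv c ∈ v) :
    hlogAt1 (σf π y) v ≤ 2 * y * hlogAt1 σtwo v := by
  have hpos : ∀ a, 0 < lamTwo π y a := by
    intro a; cases a with
    | z => exact one_pos
    | o => exact one_pos
    | mv c => show 0 < 2 * (y * π c); exact by nlinarith [(hπ c).1, hy.1]
  have h := hlogAt1_le_prod_mul_hlogAt1 (σf_adm hπ hy) σtwo_adm (lamTwo π y) hpos (pden_σf_le hπ hy hy2)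
    ((isReg_σtwo_iff v).2 hv) ((isTopReg_σtwo_iff v).2 htop)
  refine h.trans (mul_le_mul_of_nonneg_right (prod_lamTwo_le hπ hy hy2 v hmv) ?_)
  have hb : (3 / 4 : ℝ) ∈ Ioo (1 / 2 : ℝ) 1 := by norm_num
  exact (hlog_nonneg σtwo_adm ((isReg_σtwo_iff v).2 hv) ⟨by norm_num, by norm_num⟩).trans
    (hlog_le_hlogAt1 σtwo_adm ((isReg_σtwo_iff v).2 hv) ((isTopReg_σtwo_iff v).2 htop) hb)

/-- `L_v(1; σ_y) → 0` as `y → 0⁺` for a doubly regular word with a moving letter. [folklore] -/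
theorem tendsto_hlogAt1_σf {v : List (Let M)} (hv : ∀ h : v ≠ [], v.getLast h ≠ z)
    (htop : ∀ h : v ≠ [], v.head h ≠ o) (hmv : ∃ c, mv c ∈ v) :
    Tendsto (fun y => hlogAt1 (σf π y) v) (𝓝[>] 0) (𝓝 0) := by
  have hlin : Tendsto (fun y : ℝ => 2 * y * hlogAt1 σtwo v) (𝓝[>] 0) (𝓝 (2 * 0 * hlogAt1 σtwo v)) :=
    (((continuous_const.mul continuous_id).mul continuous_const).tendsto 0).mono_left nhdsWithin_le_nhds
  rw [mul_zero, zero_mul] at hlin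
  refine squeeze_zero_norm' ?_ hlin
  filter_upwards [Ioo_mem_nhdsGT (by norm_num : (0 : ℝ) < 1 / 2)] with y hy
  have hy1 : y ∈ Ioo (0 : ℝ) 1 := ⟨hy.1, by linarith [hy.2]⟩
  rw [Real.norm_eq_abs, abs_of_nonneg]
  · exact hlogAt1_σf_le hπ hy1 hy.2.le hv htop hmv
  · have hb : (3 / 4 : ℝ) ∈ Ioo (1 / 2 : ℝ) 1 := by norm_num
    have hreg := (isReg_σf_iff hπ hy1 v).2 hv
    have htop' := (isTopReg_σf_iff hπ hy1 v).2 htop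
    exact (hlog_nonneg (σf_adm hπ hy1) hreg ⟨by norm_num, by norm_num⟩).trans
      (hlog_le_hlogAt1 (σf_adm hπ hy1) hreg htop' hb)

end Cubical

/-! ### The KZ structure in the parameter: the level-2 alphabet and expansions -/

section KZParam

open Let

variable {M : Type*} [Fintype M] [DecidableEq M] (π : M → ℝ)

/-- The level-2 alphabet in the parameter `y`: `0` and the points `1/π_c ≥ 1`. [folklore] -/
def τf : Option M → ℝ
  | none => 0
  | some c => 1 / π c

/-- The densities in the parameter: `1/y` and `1/(y - 1/π_c)`. [folklore] -/
def dcoef : Option M → ℝ → ℝ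
  | none, y => 1 / y
  | some c, y => 1 / (y - 1 / π c)

/-- The signs `pden τ ℓ = sgn ℓ · dcoef ℓ` on `(0,1)`. [folklore] -/
def dsgn : Option M → ℝ
  | none => 1
  | some _ => -1

/-- Evaluation of an expansion in the regularised hyperlogarithms of the level-2 alphabet:
`E ↦ Σ_U E_U · L_U(y; τ)`. [folklore] -/
def evalE (E : List (Option M) →₀ ℝ) (y : ℝ) : ℝ := E.sum fun U a => a * hlogSeries (τf π) none y U

/-- Evaluation of a density expansion `f ↦ Σ_ℓ f_ℓ · dcoef ℓ y`. [folklore] -/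
def evalP (f : Option M →₀ ℝ) (y : ℝ) : ℝ := f.sum fun ℓ a => a * dcoef π ℓ y

/-- The primitive of `(Σ f_ℓ dcoef_ℓ) · (Σ E_U L_U)`: `Σ sgn_ℓ f_ℓ E_U · L_{ℓU}`. [folklore] -/
def primE (f : Option M →₀ ℝ) (E : List (Option M) →₀ ℝ) : List (Option M) →₀ ℝ :=
  f.sum fun ℓ a => E.sum fun U b => Finsupp.single (ℓ :: U) (dsgn ℓ * a * b)

omit [Fintype M] in
/-- `evalE` of a single. [folklore] -/
@[simp] theorem evalE_single (U : List (Option M)) (a y : ℝ) :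
    evalE π (Finsupp.single U a) y = a * hlogSeries (τf π) none y U := by
  unfold evalE; rw [Finsupp.sum_single_index]; simp

omit [Fintype M] in
/-- `evalE` is additive. [folklore] -/
theorem evalE_add (E F : List (Option M) →₀ ℝ) (y : ℝ) : evalE π (E + F) y = evalE π E y + evalE π F y := by
  unfold evalE; rw [Finsupp.sum_add_index'] <;> intros <;> simp [add_mul]

omit [Fintype M] in
/-- `evalE 0 = 0`. [folklore] -/
@[simp] theorem evalE_zero (y : ℝ) : evalE π 0 y = 0 := by simp [evalE]

omit [Fintype M] in
/-- `evalE` as an additive homomorphism. [folklore] -/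
def evalEHom (y : ℝ) : (List (Option M) →₀ ℝ) →+ ℝ where
  toFun E := evalE π E y
  map_zero' := evalE_zero π y
  map_add' E F := evalE_add π E F y

omit [Fintype M] in
/-- `evalE` of a `Finsupp.sum`. [folklore] -/
theorem evalE_finsupp_sum {ι N : Type*} [Zero N] (f : ι →₀ N) (g : ι → N → List (Option M) →₀ ℝ) (y : ℝ) :
    evalE π (f.sum g) y = f.sum fun i m => evalE π (g i m) y :=
  map_finsuppSum (evalEHom π y) f g

omit [Fintype M] in
/-- `evalE` of a difference. [folklore] -/
theorem evalE_sub (E F : List (Option M) →₀ ℝ) (y : ℝ) : evalE π (E - F) y = evalE π E y - evalE π F y :=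
  map_sub (evalEHom π y) E F

omit [Fintype M] [DecidableEq M] in
/-- `evalP` of a single. [folklore] -/
@[simp] theorem evalP_single (ℓ : Option M) (a y : ℝ) : evalP π (Finsupp.single ℓ a) y = a * dcoef π ℓ y := by
  unfold evalP; rw [Finsupp.sum_single_index]; simp

omit [Fintype M] [DecidableEq M] in
/-- `evalP` is additive. [folklore] -/
theorem evalP_add (f g : Option M →₀ ℝ) (y : ℝ) : evalP π (f + g) y = evalP π f y + evalP π g y := by
  unfold evalP; rw [Finsupp.sum_add_index'] <;> intros <;> simp [add_mul]

omit [Fintype M] [DecidableEq M] in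
/-- `evalP 0 = 0`. [folklore] -/
@[simp] theorem evalP_zero (y : ℝ) : evalP π 0 y = 0 := by simp [evalP]

omit [Fintype M] [DecidableEq M] in
/-- `evalP` as an additive homomorphism. [folklore] -/
def evalPHom (y : ℝ) : (Option M →₀ ℝ) →+ ℝ where
  toFun f := evalP π f y
  map_zero' := evalP_zero π y
  map_add' f g := evalP_add π f g y

omit [Fintype M] [DecidableEq M] in
/-- `evalP` of a difference. [folklore] -/
theorem evalP_sub (f g : Option M →₀ ℝ) (y : ℝ) : evalP π (f - g) y = evalP π f y - evalP π g y :=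
  map_sub (evalPHom π y) f g

variable {π} (hπ : ∀ c, 0 < π c ∧ π c ≤ 1)
include hπ

omit [Fintype M] [DecidableEq M] in
/-- The level-2 alphabet is admissible: `τ (some c) ≥ 1`. [folklore] -/
theorem τf_adm : ∀ ℓ : Option M, ℓ ≠ none → 1 ≤ τf π ℓ
  | none, h => (h rfl).elim
  | some c, _ => by
    show 1 ≤ 1 / π c
    rw [le_div_iff₀ (hπ c).1]; linarith [(hπ c).2]

omit [Fintype M] [DecidableEq M] in
/-- `pden τ ℓ y = sgn ℓ · dcoef ℓ y` on `(0,1)`. [folklore] -/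
theorem pden_τf {y : ℝ} (hy : y ∈ Ioo (0 : ℝ) 1) : ∀ ℓ : Option M, pden (τf π) ℓ y = dsgn ℓ * dcoef π ℓ y
  | none => by rw [pden_of_eq_zero (σ := τf π) (c := none) rfl hy.1]; simp [dsgn, dcoef]
  | some c => by
    have hadm := adm_of_zero_letter (τf π) (z := none) rfl (τf_adm hπ)
    have h1 : (1 : ℝ) ≤ 1 / π c := τf_adm hπ (some c) (by simp)
    rw [pden_of_ne_zero hadm (c := some c) (by show (1 : ℝ) / π c ≠ 0; linarith) hy.2]
    show 1 / (1 / π c - y) = -1 * (1 / (y - 1 / π c))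
    have hne : 1 / π c - y ≠ 0 := by linarith [hy.2]
    have hne' : y - 1 / π c ≠ 0 := by linarith [hy.2]
    field_simp
    ring

omit [Fintype M] in
/-- **The derivative of the primitive expansion**:
`∂_y evalE (primE f E) = evalP f · evalE E` on `(0,1)`. [folklore] -/
theorem hasDerivAt_evalE_primE (f : Option M →₀ ℝ) (E : List (Option M) →₀ ℝ) {y : ℝ} (hy : y ∈ Ioo (0 : ℝ) 1) :
    HasDerivAt (evalE π (primE f E)) (evalP π f y * evalE π E y) y := by
  classical
  have hz : τf π none = 0 := rfl
  have hσz := τf_adm hπ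
  -- expand everything into finite double sums
  have hfun : evalE π (primE f E) = fun y => ∑ ℓ ∈ f.support, ∑ U ∈ E.support,
      dsgn ℓ * f ℓ * E U * hlogSeries (τf π) none y (ℓ :: U) := by
    funext y'
    unfold primE
    simp only [evalE_finsupp_sum, evalE_single]
    simp only [Finsupp.sum]
  rw [hfun]
  have hder : ∀ ℓ ∈ f.support, ∀ U ∈ E.support, HasDerivAt (fun y => dsgn ℓ * f ℓ * E U * hlogSeries (τf π) none y (ℓ :: U))
      (dsgn ℓ * f ℓ * E U * (pden (τf π) ℓ y * hlogSeries (τf π) none y U)) y :=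
    fun ℓ _ U _ => (hasDerivAt_hlogSeries_cons hz hσz ℓ U hy).const_mul _
  have hsum := HasDerivAt.sum (u := f.support) (A := fun ℓ y => ∑ U ∈ E.support,
      dsgn ℓ * f ℓ * E U * hlogSeries (τf π) none y (ℓ :: U))
    (A' := fun ℓ => ∑ U ∈ E.support, dsgn ℓ * f ℓ * E U * (pden (τf π) ℓ y * hlogSeries (τf π) none y U))
    (x := y) fun ℓ hℓ => by
      have h := HasDerivAt.sum (u := E.support) (A := fun U y => dsgn ℓ * f ℓ * E U * hlogSeries (τf π) none y (ℓ :: U))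
        (A' := fun U => dsgn ℓ * f ℓ * E U * (pden (τf π) ℓ y * hlogSeries (τf π) none y U)) (x := y)
        fun U hU => hder ℓ hℓ U hU
      have hf2 : (fun y => ∑ U ∈ E.support, dsgn ℓ * f ℓ * E U * hlogSeries (τf π) none y (ℓ :: U)) =
          ∑ U ∈ E.support, fun y => dsgn ℓ * f ℓ * E U * hlogSeries (τf π) none y (ℓ :: U) := by
        funext y'; rw [Finset.sum_apply]
      rw [hf2]; exact h
  have hf1 : (fun y => ∑ ℓ ∈ f.support, ∑ U ∈ E.support, dsgn ℓ * f ℓ * E U * hlogSeries (τf π) none y (ℓ :: U)) =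
      ∑ ℓ ∈ f.support, fun y => ∑ U ∈ E.support, dsgn ℓ * f ℓ * E U * hlogSeries (τf π) none y (ℓ :: U) := by
    funext y'; rw [Finset.sum_apply]
  rw [hf1]
  refine hsum.congr_deriv ?_
  -- `Σ_ℓ Σ_U sgn f E (pden L_U) = (Σ_ℓ f dcoef) (Σ_U E L_U)`
  unfold evalP evalE
  simp only [Finsupp.sum, Finset.sum_mul, Finset.mul_sum]
  rw [Finset.sum_comm (s := E.support) (t := f.support)]
  refine Finset.sum_congr rfl fun ℓ _ => Finset.sum_congr rfl fun U _ => ?_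
  rw [pden_τf hπ hy ℓ]
  have : dsgn ℓ * dsgn ℓ = (1 : ℝ) := by cases ℓ <;> simp [dsgn]
  linear_combination (f ℓ * E U * dcoef π ℓ y * hlogSeries (τf π) none y U) * this

/-! #### The pairing table of the cubical family -/

/-- The expansion of the pairing `Λ(a, a')` in the densities `1/y`, `1/(y - 1/π_c)`. [folklore] -/
def pairE : Let M → Let M → Option M →₀ ℝ
  | mv c, mv c' => if c = c' then 0 else Finsupp.single none (-1)
  | mv c, o => Finsupp.single none (-1) + Finsupp.single (some c) 1
  | o, mv c => Finsupp.single none (-1) + Finsupp.single (some c) 1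
  | mv _, z => Finsupp.single none (-1)
  | z, mv _ => Finsupp.single none 1
  | _, _ => 0

/-- The expansion of the base pairing `Λ(a, 0)`. [folklore] -/
def baseE : Let M → Option M →₀ ℝ
  | mv _ => Finsupp.single none (-1)
  | _ => 0

/-- The expansion of the end-point pairing `Λ(a, 1⁻)`. [folklore] -/
def end1E : Let M → Option M →₀ ℝ
  | mv c => Finsupp.single none (-1) + Finsupp.single (some c) 1
  | _ => 0

omit [Fintype M] [DecidableEq M] in
/-- The key relation of the family: `σ'_c = -σ_c/y`. [folklore] -/
theorem σf'_mv {y : ℝ} (hy : y ∈ Ioo (0 : ℝ) 1) (c : M) : σf' π y (mv c) = -σf π y (mv c) / y := by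
  have hy0 : y ≠ 0 := hy.1.ne'
  have h0 : π c ≠ 0 := (hπ c).1.ne'
  simp only [σf, σf']
  field_simp

omit [Fintype M] [DecidableEq M] in
/-- `1/π_c = y σ_c`. [folklore] -/
theorem one_div_pi {y : ℝ} (hy : y ∈ Ioo (0 : ℝ) 1) (c : M) : 1 / π c = y * σf π y (mv c) := by
  have hy0 : y ≠ 0 := hy.1.ne'
  have h0 : π c ≠ 0 := (hπ c).1.ne'
  simp only [σf]
  field_simp

omit [Fintype M] [DecidableEq M] in
/-- The density `1/(y - 1/π_c) = -1/(y (σ_c - 1))`. [folklore] -/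
theorem dcoef_some {y : ℝ} (hy : y ∈ Ioo (0 : ℝ) 1) (c : M) : dcoef π (some c) y = -1 / (y * (σf π y (mv c) - 1)) := by
  have hy0 : y ≠ 0 := hy.1.ne'
  have hA : 1 < σf π y (mv c) := one_lt_σf_mv hπ hy c
  show 1 / (y - 1 / π c) = _
  rw [one_div_pi hπ hy c]
  have h1 : σf π y (mv c) - 1 ≠ 0 := by linarith
  have h2 : 1 - σf π y (mv c) ≠ 0 := by linarith
  have h3 : y - y * σf π y (mv c) = y * (1 - σf π y (mv c)) := by ring
  rw [h3]
  field_simp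
  ring

omit [Fintype M] [DecidableEq M] hπ in
/-- `dcoef none y = 1/y`. [folklore] -/
theorem dcoef_none (y : ℝ) : dcoef π none y = 1 / y := rfl

omit [Fintype M] [DecidableEq M] in
/-- The signs of the densities: `ε_z = 1`, `ε_o = ε_c = -1`. [folklore] -/
theorem lsign_σf {y : ℝ} (hy : y ∈ Ioo (0 : ℝ) 1) :
    lsign (σf π y) z = 1 ∧ lsign (σf π y) o = -1 ∧ ∀ c, lsign (σf π y) (mv c) = -1 := by
  refine ⟨by simp [lsign, σf], by simp [lsign, σf], fun c => ?_⟩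
  rw [lsign, if_neg (zero_lt_one.trans (one_lt_σf_mv hπ hy c)).ne']

omit [Fintype M] in
/-- **The pairing table.** `Λ(a,a')(σ_y) = evalP (pairE a a') y` on `(0,1)`. [folklore] -/
theorem lam_σf_eq (hπi : Function.Injective π) {y : ℝ} (hy : y ∈ Ioo (0 : ℝ) 1) (a a' : Let M) :
    lam (σf π y) (σf' π y) a a' = evalP π (pairE a a') y := by
  have hy0 : y ≠ 0 := hy.1.ne'
  have hinj := σf_injective hπ hπi hy
  have hval : ∀ b b' : Let M, σf π y b = σf π y b' ↔ b = b' := fun b b' => ⟨hinj b b', fun h => by rw [h]⟩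
  obtain ⟨hsz, hso, hsm⟩ := lsign_σf hπ hy
  have hz0 : σf π y z = 0 := rfl
  have ho1 : σf π y o = 1 := rfl
  have hz' : σf' π y z = 0 := rfl
  have ho' : σf' π y o = 0 := rfl
  cases a with
  | z =>
    cases a' with
    | z => simp [lam, pairE]
    | o => rw [lam, if_neg (by rw [hval]; simp)]; simp [pairE, hz', ho', hsz]
    | mv c =>
      have hA : 1 < σf π y (mv c) := one_lt_σf_mv hπ hy c
      rw [lam, if_neg (by rw [hval]; simp), hsz, hz', σf'_mv hπ hy c, hz0]
      simp only [pairE, evalP_single, dcoef_none, one_mul, zero_add, zero_sub]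
      have : σf π y (mv c) ≠ 0 := by linarith
      field_simp
  | o =>
    cases a' with
    | z => rw [lam, if_neg (by rw [hval]; simp)]; simp [pairE, hz', ho', hso]
    | o => simp [lam, pairE]
    | mv c =>
      have hA : 1 < σf π y (mv c) := one_lt_σf_mv hπ hy c
      rw [lam, if_neg (by rw [hval]; simp), hso, ho', σf'_mv hπ hy c, ho1]
      simp only [pairE, evalP_add, evalP_single, dcoef_some hπ hy c, dcoef_none, neg_mul, one_mul, zero_add]
      have h1 : σf π y (mv c) - 1 ≠ 0 := by linarith
      have h2 : 1 - σf π y (mv c) ≠ 0 := by linarith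
      field_simp
      ring
  | mv c =>
    have hA : 1 < σf π y (mv c) := one_lt_σf_mv hπ hy c
    have hA0 : σf π y (mv c) ≠ 0 := by linarith
    cases a' with
    | z =>
      rw [lam, if_neg (by rw [hval]; simp), hsm c, hz', σf'_mv hπ hy c, hz0]
      simp only [pairE, evalP_single, dcoef_none, mul_zero, add_zero, sub_zero]
      field_simp
    | o =>
      rw [lam, if_neg (by rw [hval]; simp), hsm c, ho', σf'_mv hπ hy c, ho1]
      simp only [pairE, evalP_add, evalP_single, dcoef_some hπ hy c, dcoef_none, mul_zero, add_zero, one_mul, neg_mul]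
      have h1 : σf π y (mv c) - 1 ≠ 0 := by linarith
      field_simp
      ring
    | mv c' =>
      by_cases hcc : c = c'
      · subst hcc; simp [lam, pairE]
      · have hne : σf π y (mv c) ≠ σf π y (mv c') := by rw [Ne, hval]; simpa using hcc
        have hsub : σf π y (mv c) - σf π y (mv c') ≠ 0 := sub_ne_zero.2 hne
        rw [lam, if_neg hne, hsm c, σf'_mv hπ hy c, σf'_mv hπ hy c']
        simp only [pairE, if_neg hcc, evalP_single, dcoef_none]
        field_simp
        ring

omit [Fintype M] [DecidableEq M] in
/-- The base pairing table: `Λ(c,0) = -1/y`, `Λ(z,0) = Λ(o,0) = 0`. [folklore] -/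
theorem lamBase_σf_eq {y : ℝ} (hy : y ∈ Ioo (0 : ℝ) 1) (a : Let M) :
    lamBase (σf π y) (σf' π y) a = evalP π (baseE a) y := by
  have hy0 : y ≠ 0 := hy.1.ne'
  cases a with
  | z => simp [lamBase, baseE, σf]
  | o => simp [lamBase, baseE, σf, σf']
  | mv c =>
    have hA : 1 < σf π y (mv c) := one_lt_σf_mv hπ hy c
    have hA0 : σf π y (mv c) ≠ 0 := by linarith
    rw [lamBase, if_neg hA0, σf'_mv hπ hy c]
    simp only [baseE, evalP_single, dcoef_none]
    field_simp

omit [Fintype M] [DecidableEq M] in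
/-- The end-point pairing table: `Λ(c,1⁻) = -1/y + 1/(y - 1/π_c)`, `Λ(z,1⁻) = Λ(o,1⁻) = 0`.
[folklore] -/
theorem lamEnd1_σf_eq {y : ℝ} (hy : y ∈ Ioo (0 : ℝ) 1) (a : Let M) :
    lamEnd1 (σf π y) (σf' π y) a = evalP π (end1E a) y := by
  have hy0 : y ≠ 0 := hy.1.ne'
  cases a with
  | z => simp [lamEnd1, end1E, σf]
  | o => simp [lamEnd1, end1E, σf, σf']
  | mv c =>
    have hA : 1 < σf π y (mv c) := one_lt_σf_mv hπ hy c
    have hA0 : σf π y (mv c) ≠ 0 := by linarith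
    rw [lamEnd1, if_neg hA0, σf'_mv hπ hy c]
    simp only [end1E, evalP_add, evalP_single, dcoef_some hπ hy c, dcoef_none, one_mul, neg_mul]
    have h1 : σf π y (mv c) - 1 ≠ 0 := by linarith
    field_simp
    ring

end KZParam

/-! ### The KZ induction: `L_v(1; σ_y)` is a hyperlogarithm in `y` -/

section KZInduction

open Let

variable {M : Type*} [Fintype M] [DecidableEq M] {π : M → ℝ} (hπ : ∀ c, 0 < π c ∧ π c ≤ 1)
  (hπi : Function.Injective π)

/-- Doubly regular words of the level alphabet: not ending with `z`, not starting with `o`. [folklore] -/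
def IsDReg (v : List (Let M)) : Prop := (∀ h : v ≠ [], v.getLast h ≠ z) ∧ (∀ h : v ≠ [], v.head h ≠ o)

omit [Fintype M] [DecidableEq M] in
/-- The empty word is doubly regular. [folklore] -/
theorem isDReg_nil : IsDReg ([] : List (Let M)) := ⟨fun h => (h rfl).elim, fun h => (h rfl).elim⟩

/-- The expansion of the inner pairing. [folklore] -/
def inE (a : Let M) : List (Let M) → (Option M →₀ ℝ)
  | [] => baseE a
  | a' :: _ => pairE a a'

/-- The expansion of the inner deletion sums (mirror of `Dsum1`). [folklore] -/
def DsumE (X : List (Let M) → (List (Option M) →₀ ℝ)) : List (Let M) → Let M → List (Let M) → (List (Option M) →₀ ℝ)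
  | _, _, [] => 0
  | pre, c₀, a :: u => primE (inE a u - pairE a c₀) (X (pre ++ u)) + DsumE X (pre ++ [a]) a u

/-- The expansion of the deletion sum at the top (mirror of `Dtop`). [folklore] -/
def DtopE (X : List (Let M) → (List (Option M) →₀ ℝ)) : List (Let M) → (List (Option M) →₀ ℝ)
  | [] => 0
  | c :: u => primE (inE c u - end1E c) (X u) + DsumE X [c] c u

include hπ hπi

omit [Fintype M] in
/-- The inner pairing in the family. [folklore] -/
theorem lamIn_σf_eq {y : ℝ} (hy : y ∈ Ioo (0 : ℝ) 1) (a : Let M) (u : List (Let M)) :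
    lamIn (σf π y) (σf' π y) a u = evalP π (inE a u) y := by
  cases u with
  | nil => exact lamBase_σf_eq hπ hy a
  | cons a' _ => exact lam_σf_eq hπ hπi hy a a'

omit [Fintype M] in
/-- **Derivative of the inner expansion**: mirror of `Dsum1` under the inductive hypothesis. [folklore] -/
theorem hasDerivAt_evalE_DsumE {n : ℕ} (X : List (Let M) → (List (Option M) →₀ ℝ))
    (hX : ∀ w : List (Let M), w.length < n →
      (IsDReg w → ∀ y ∈ Ioo (0 : ℝ) 1, hlogAt1 (σf π y) w = evalE π (X w) y) ∧ (¬IsDReg w → X w = 0)) :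
    ∀ (u : List (Let M)), (∀ h : u ≠ [], u.getLast h ≠ z) → ∀ (pre : List (Let M)) (c₀ : Let M),
    (∀ h : (pre ++ [c₀]) ≠ [], (pre ++ [c₀]).head h ≠ o) → pre.length + 1 + u.length ≤ n →
    ∀ {y : ℝ}, y ∈ Ioo (0 : ℝ) 1 →
    HasDerivAt (fun y => evalE π (DsumE X (pre ++ [c₀]) c₀ u) y)
      (Dsum1 (σf π y) (σf' π y) (pre ++ [c₀]) (some c₀) u) y := by
  intro u
  induction u with
  | nil => intro _ pre c₀ _ _ y _; simpa [DsumE, Dsum1] using hasDerivAt_const y (0 : ℝ)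
  | cons a u IH =>
    intro hlast pre c₀ hhead hlen y hy
    have hlast' : ∀ h : u ≠ [], u.getLast h ≠ z := fun h => by
      have := hlast (List.cons_ne_nil a u); rwa [List.getLast_cons h] at this
    have hhead' : ∀ h : (pre ++ [c₀] ++ [a]) ≠ [], (pre ++ [c₀] ++ [a]).head h ≠ o := by
      intro h; cases pre with
      | nil => simpa using hhead (by simp)
      | cons p ps => simpa using hhead (by simp)
    have IH' := IH hlast' (pre ++ [c₀]) a hhead' (by simp at hlen ⊢; omega) hy
    simp only [DsumE, Dsum1]
    have hfun : (fun y => evalE π (primE (inE a u - pairE a c₀) (X (pre ++ [c₀] ++ u)) +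
        DsumE X (pre ++ [c₀] ++ [a]) a u) y) = fun y => evalE π (primE (inE a u - pairE a c₀) (X (pre ++ [c₀] ++ u))) y +
        evalE π (DsumE X (pre ++ [c₀] ++ [a]) a u) y := by funext y'; rw [evalE_add]
    rw [hfun]
    refine HasDerivAt.add ?_ (by simpa using IH')
    have hder := hasDerivAt_evalE_primE hπ (inE a u - pairE a c₀) (X (pre ++ [c₀] ++ u)) hy
    refine hder.congr_deriv ?_
    rw [evalP_sub, ← lamIn_σf_eq hπ hπi hy a u, ← lam_σf_eq hπ hπi hy a c₀]
    simp only [lamOut]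
    -- is the deleted word doubly regular?
    have hlt : (pre ++ [c₀] ++ u).length < n := by simp at hlen ⊢; omega
    by_cases hdr : IsDReg (pre ++ [c₀] ++ u)
    · rw [(hX _ hlt).1 hdr y hy]
    · rw [(hX _ hlt).2 hdr, evalE_zero, mul_zero]
      -- then `u = []` and `c₀ = z`: the coefficient vanishes
      have hu : u = [] ∧ c₀ = z := by
        by_contra hcon
        apply hdr
        refine ⟨fun h => ?_, fun h => ?_⟩
        · by_cases hu0 : u = []
          · subst hu0
            have hc : c₀ ≠ z := fun hc => hcon ⟨rfl, hc⟩
            simpa using hc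
          · rw [List.getLast_append_of_ne_nil _ hu0]; exact hlast' hu0
        · have : (pre ++ [c₀] ++ u).head h = (pre ++ [c₀]).head (by simp) := by
            cases pre with
            | nil => simp
            | cons p ps => simp
          rw [this]; exact hhead _
      obtain ⟨hu0, hc0⟩ := hu
      subst hu0; subst hc0
      rw [lamIn_nil_sub_lam_eq_zero (σ := σf π y) (σ' := σf' π y) (fun c hc => by
        rw [(σf_eq_zero_iff hπ hy c).1 hc]; rfl) a z rfl, zero_mul]

omit [Fintype M] in
/-- **Derivative of the top expansion**: mirror of `Dtop` under the inductive hypothesis. [folklore] -/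
theorem hasDerivAt_evalE_DtopE {n : ℕ} (X : List (Let M) → (List (Option M) →₀ ℝ))
    (hX : ∀ w : List (Let M), w.length < n →
      (IsDReg w → ∀ y ∈ Ioo (0 : ℝ) 1, hlogAt1 (σf π y) w = evalE π (X w) y) ∧ (¬IsDReg w → X w = 0))
    {v : List (Let M)} (hv : IsDReg v) (hlen : v.length ≤ n) {y : ℝ} (hy : y ∈ Ioo (0 : ℝ) 1) :
    HasDerivAt (fun y => evalE π (DtopE X v) y) (Dtop (σf π y) (σf' π y) v) y := by
  cases v with
  | nil => simpa [DtopE, Dtop] using hasDerivAt_const y (0 : ℝ)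
  | cons c u =>
    have hc : c ≠ o := by have := hv.2 (List.cons_ne_nil c u); simpa using this
    have hlast : ∀ h : u ≠ [], u.getLast h ≠ z := fun h => by
      have := hv.1 (List.cons_ne_nil c u); rwa [List.getLast_cons h] at this
    simp only [DtopE, Dtop]
    have hfun : (fun y => evalE π (primE (inE c u - end1E c) (X u) + DsumE X [c] c u) y) =
        fun y => evalE π (primE (inE c u - end1E c) (X u)) y + evalE π (DsumE X [c] c u) y := by
      funext y'; rw [evalE_add]
    rw [hfun]
    have htail := hasDerivAt_evalE_DsumE hπ hπi X hX u hlast [] c (by simpa using hc)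
      (by simp only [List.length_cons] at hlen; simp only [List.length_nil]; omega) hy
    refine HasDerivAt.add ?_ (by simpa using htail)
    have hder := hasDerivAt_evalE_primE hπ (inE c u - end1E c) (X u) hy
    refine hder.congr_deriv ?_
    rw [evalP_sub, ← lamIn_σf_eq hπ hπi hy c u, ← lamEnd1_σf_eq hπ hy c]
    have hlt : u.length < n := by simp at hlen; omega
    by_cases hdr : IsDReg u
    · rw [(hX _ hlt).1 hdr y hy]
    · rw [(hX _ hlt).2 hdr, evalE_zero, mul_zero]
      -- then `u` starts with `o`: the coefficient vanishes
      have hu0 : u ≠ [] := by rintro rfl; exact hdr isDReg_nil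
      obtain ⟨a, u', rfl⟩ := List.exists_cons_of_ne_nil hu0
      have ha : a = o := by
        by_contra h
        exact hdr ⟨fun _ => hlast _, fun _ => by simpa using h⟩
      subst ha
      simp only [lamIn]
      rw [lam_sub_lamEnd1_eq_zero (σ := σf π y) (σ' := σf' π y)
        (fun c hc => by rw [(σf_eq_zero_iff hπ hy c).1 hc]; rfl)
        (fun c hc => by rw [(σf_eq_one_iff hπ hy c).1 hc]; rfl)
        (by rw [Ne, σf_eq_one_iff hπ hy]; exact hc) rfl, zero_mul]

/-- The family hypotheses of Theorem T1b for the cubical family. [folklore] -/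
theorem hasDerivAt_hlogAt1_σf {v : List (Let M)} (hv : IsDReg v) {y₀ : ℝ} (hy₀ : y₀ ∈ Ioo (0 : ℝ) 1) :
    HasDerivAt (fun y => hlogAt1 (σf π y) v) (Dtop (σf π y₀) (σf' π y₀) v) y₀ := by
  refine hasDerivAt_hlogAt1_family (σ := σf π) (σ' := σf' π) (Y := Ioo 0 1) isOpen_Ioo
    (fun y hy => σf_adm hπ hy) (fun c => ?_) (fun y hy c hc => ?_) (fun c => ?_) (fun y hy c hc => ?_)
    (fun y hy => σf_injective hπ hπi hy) (fun y hy => hasDerivAt_σf hπ hy) (continuousOn_σf' hπ)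
    (fun y hy => (isReg_σf_iff hπ hy v).2 hv.1) (fun y hy => (isTopReg_σf_iff hπ hy v).2 hv.2) hy₀
  · cases c with
    | z => exact Or.inl fun y _ => rfl
    | o => exact Or.inr fun y hy => by rw [Ne, σf_eq_zero_iff hπ hy]; simp
    | mv c => exact Or.inr fun y hy => by rw [Ne, σf_eq_zero_iff hπ hy]; simp
  · rw [(σf_eq_zero_iff hπ hy c).1 hc]; rfl
  · cases c with
    | z => exact Or.inr fun y hy => by rw [Ne, σf_eq_one_iff hπ hy]; simp
    | o => exact Or.inl fun y _ => rfl
    | mv c => exact Or.inr fun y hy => by rw [Ne, σf_eq_one_iff hπ hy]; simp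
  · rw [(σf_eq_one_iff hπ hy c).1 hc]; rfl

/-- **Theorem T4 (the KZ structure in the parameter).** For every doubly regular word `v` of the
level alphabet there is a finite expansion `E_v` such that for all `y ∈ (0,1)`
`L_v(1; {0, 1, 1/(yπ_c)}) = Σ_U (E_v)_U · L_U(y; {0, 1/π_c})`: the values at `1` of the
hyperlogarithms of the cubical family are regularised hyperlogarithms IN THE PARAMETER for the
next alphabet. [cite: BrownENS2009, §5.3, §6.3 (restriction to faces), Thm 6.25 (analogue)] -/
theorem exists_expansion : ∀ n : ℕ, ∃ X : List (Let M) → (List (Option M) →₀ ℝ),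
    ∀ w : List (Let M), w.length ≤ n →
      (IsDReg w → ∀ y ∈ Ioo (0 : ℝ) 1, hlogAt1 (σf π y) w = evalE π (X w) y) ∧ (¬IsDReg w → X w = 0) := by
  classical
  intro n
  induction n with
  | zero =>
    refine ⟨fun w => if w = [] then Finsupp.single [] 1 else 0, fun w hw => ?_⟩
    have hw0 : w = [] := List.length_eq_zero_iff.mp (Nat.le_zero.1 hw)
    subst hw0
    refine ⟨fun _ y hy => ?_, fun h => absurd isDReg_nil h⟩
    simp only [if_true, evalE_single]
    rw [hlogSeries_nil (σ := τf π) rfl (τf_adm hπ) hy, mul_one, hlogAt1_nil (σf_adm hπ hy)]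
  | succ n IH =>
    obtain ⟨X, hX⟩ := IH
    have hhalf : (1 / 2 : ℝ) ∈ Ioo (0 : ℝ) 1 := by norm_num
    set K : List (Let M) → ℝ := fun w => hlogAt1 (σf π (1 / 2)) w - evalE π (DtopE X w) (1 / 2) with hK
    refine ⟨fun w => if w.length ≤ n then X w else
      if IsDReg w then Finsupp.single [] (K w) + DtopE X w else 0, fun w hw => ?_⟩
    by_cases hwn : w.length ≤ n
    · simp only [hwn, if_true]; exact hX w hwn
    · have hwlen : w.length = n + 1 := by omega
      simp only [hwn, if_false]
      refine ⟨fun hdr y hy => ?_, fun hdr => by rw [if_neg hdr]⟩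
      rw [if_pos hdr, evalE_add, evalE_single, hlogSeries_nil (σ := τf π) rfl (τf_adm hπ) hy, mul_one]
      -- `G = L_w(1; σ_y) - evalE (DtopE X w) y` has zero derivative on `(0,1)`
      have hX' : ∀ w' : List (Let M), w'.length < n + 1 →
          (IsDReg w' → ∀ y ∈ Ioo (0 : ℝ) 1, hlogAt1 (σf π y) w' = evalE π (X w') y) ∧ (¬IsDReg w' → X w' = 0) :=
        fun w' hw' => hX w' (by omega)
      have hG : ∀ y' ∈ Ioo (0 : ℝ) 1, HasDerivAt (fun y => hlogAt1 (σf π y) w - evalE π (DtopE X w) y) 0 y' := by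
        intro y' hy'
        have h1 := hasDerivAt_hlogAt1_σf hπ hπi hdr hy'
        have h2 := hasDerivAt_evalE_DtopE hπ hπi X hX' hdr (le_of_eq hwlen) hy'
        have h := h1.sub h2
        rwa [sub_self] at h
      have hconst := isOpen_Ioo.is_const_of_deriv_eq_zero (𝕜 := ℝ) (f := fun y => hlogAt1 (σf π y) w - evalE π (DtopE X w) y)
        isPreconnected_Ioo (fun y' hy' => (hG y' hy').differentiableAt.differentiableWithinAt)
        (fun y' hy' => (hG y' hy').deriv) hy hhalf
      have hKw : K w = hlogAt1 (σf π (1 / 2)) w - evalE π (DtopE X w) (1 / 2) := rfl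
      rw [hKw]
      linarith

/-- **Theorem T4**, packaged. [cite: BrownENS2009, §5.3, §6.3, Thm 6.25 (analogue)] -/
theorem hlogAt1_σf_eq_evalE {v : List (Let M)} (hv : IsDReg v) :
    ∃ E : List (Option M) →₀ ℝ, ∀ y ∈ Ioo (0 : ℝ) 1, hlogAt1 (σf π y) v = evalE π E y := by
  obtain ⟨X, hX⟩ := exists_expansion hπ hπi v.length
  exact ⟨X v, (hX v le_rfl).1 hv⟩

end KZInduction

/-! ### Coefficients: the expansions have multiple-zeta-value entries of the right weights -/

section Coefficients

open Let

variable {M : Type*} [Fintype M] [DecidableEq M] {π : M → ℝ} (hπ : ∀ c, 0 < π c ∧ π c ≤ 1)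
  (hπi : Function.Injective π)

/-! #### Alphabet congruence and relabelling -/

omit [Fintype M] [DecidableEq M] in
/-- Iterated integrals only see the densities of the letters of the word. [folklore] -/
theorem iterInt_congr_mem {β : Type*} {f g : β → ℝ → ℝ} : ∀ (w : List β), (∀ c ∈ w, f c = g c) →
    ∀ (a b : ℝ), iterInt f w a b = iterInt g w a b
  | [], _, _, _ => rfl
  | c :: w, h, a, b => by
    rw [iterInt_cons, iterInt_cons]
    refine intervalIntegral.integral_congr fun t _ => ?_
    rw [h c (by simp), iterInt_congr_mem w (fun c' hc' => h c' (by simp [hc'])) a t]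

omit [Fintype M] [DecidableEq M] in
/-- Relabelling of iterated integrals. [folklore] -/
theorem iterInt_map' {β γ : Type*} (f : γ → ℝ → ℝ) (κ : β → γ) (a : ℝ) : ∀ (w : List β) (b : ℝ),
    iterInt f (w.map κ) a b = iterInt (fun c => f (κ c)) w a b
  | [], _ => rfl
  | c :: w, b => by
    rw [List.map_cons, iterInt_cons, iterInt_cons]
    exact intervalIntegral.integral_congr fun t _ => by rw [iterInt_map' f κ a w t]

omit [Fintype M] [DecidableEq M] in
/-- Hyperlogarithms only see the positions of the letters of the word. [folklore] -/
theorem hlog_congr_mem {β : Type*} {σ σ₂ : β → ℝ} {w : List β} (h : ∀ c ∈ w, σ c = σ₂ c) (b : ℝ) :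
    hlog σ w b = hlog σ₂ w b := by
  unfold hlog
  have : ∀ ε, iterInt (pden σ) w ε b = iterInt (pden σ₂) w ε b := fun ε =>
    iterInt_congr_mem w (fun c hc => by funext t; simp only [pden, h c hc]) ε b
  simp only [this]

omit [Fintype M] [DecidableEq M] in
/-- The values at `1` only see the positions of the letters of the word. [folklore] -/
theorem hlogAt1_congr_mem {β : Type*} [Fintype β] [DecidableEq β] {σ σ₂ : β → ℝ} {w : List β}
    (h : ∀ c ∈ w, σ c = σ₂ c) : hlogAt1 σ w = hlogAt1 σ₂ w := by
  unfold hlogAt1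
  have : hlog σ w = hlog σ₂ w := funext fun b => hlog_congr_mem h b
  rw [this]

omit [Fintype M] [DecidableEq M] in
/-- Relabelling of hyperlogarithms. [folklore] -/
theorem hlog_map {β γ : Type*} (ρ : γ → ℝ) (κ : β → γ) (w : List β) (b : ℝ) :
    hlog ρ (w.map κ) b = hlog (ρ ∘ κ) w b := by
  unfold hlog
  have : ∀ ε, iterInt (pden ρ) (w.map κ) ε b = iterInt (pden (ρ ∘ κ)) w ε b := fun ε => by
    rw [iterInt_map']; rfl
  simp only [this]

omit [Fintype M] [DecidableEq M] in
/-- Relabelling of the values at `1`. [folklore] -/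
theorem hlogAt1_map {β γ : Type*} [Fintype β] [DecidableEq β] [Fintype γ] [DecidableEq γ]
    (ρ : γ → ℝ) (κ : β → γ) (w : List β) : hlogAt1 ρ (w.map κ) = hlogAt1 (ρ ∘ κ) w := by
  unfold hlogAt1
  have : hlog ρ (w.map κ) = hlog (ρ ∘ κ) w := funext fun b => hlog_map ρ κ w b
  rw [this]

/-! #### The constants: words without moving letters give multiple zeta values -/

/-- The letter types: `z ↦ false` (at `0`), `o ↦ true` (at `1`), moving letters `↦ true`. [folklore] -/
def κb : Let M → Bool
  | z => false
  | o => true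
  | mv _ => true

omit [Fintype M] [DecidableEq M] in
/-- A doubly regular word without moving letters maps to a convergent binary word. [folklore] -/
theorem isConvWord_map_κb {v : List (Let M)} (hv : IsDReg v) (hnm : ∀ c, mv c ∉ v) :
    KZ3.IsConvWord (v.map κb) := by
  by_cases hv0 : v = []
  · subst hv0; exact ⟨Or.inl rfl, Or.inl rfl⟩
  refine ⟨Or.inr ?_, Or.inr ?_⟩
  · obtain ⟨a, u, rfl⟩ := List.exists_cons_of_ne_nil hv0
    have ha : a ≠ o := hv.2 (List.cons_ne_nil a u)
    cases a with
    | z => rfl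
    | o => exact absurd rfl ha
    | mv c => exact absurd (by simp) (hnm c)
  · have hl : v.getLast hv0 ≠ z := hv.1 hv0
    rw [List.getLast?_eq_some_getLast (by simpa using hv0), List.getLast_map, Option.some.injEq]
    generalize hx : v.getLast hv0 = x at hl
    have hxv : x ∈ v := hx ▸ List.getLast_mem hv0
    cases x with
    | z => exact absurd rfl hl
    | o => rfl
    | mv c => exact absurd hxv (hnm c)

/-- **Words without moving letters**: `L_v(1; σ_y) = ζ(v)` for every parameter. [folklore] -/
theorem hlogAt1_σf_of_noMoving {v : List (Let M)} (hv : IsDReg v) (hnm : ∀ c, mv c ∉ v) (y : ℝ) :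
    hlogAt1 (σf π y) v = multipleZeta (MZV.ofBinaryWord (v.map κb)) := by
  rw [← hlogAt1_boolLetters (isConvWord_map_κb hv hnm), hlogAt1_map]
  refine hlogAt1_congr_mem fun c hc => ?_
  cases c with
  | z => simp [σf, κb, boolLetters]
  | o => simp [σf, κb, boolLetters]
  | mv c => exact absurd hc (hnm c)

/-- The constant of the expansion of `v`: `0` if `v` has a moving letter, `ζ(v)` otherwise. [folklore] -/
def Kconst (v : List (Let M)) : ℝ :=
  if ∃ c, mv c ∈ v then 0 else multipleZeta (MZV.ofBinaryWord (v.map κb))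

include hπ in
/-- **The regularised value at `y → 0⁺` of `L_v(1; σ_y)` is the constant `Kconst v`.** [folklore] -/
theorem hasRegValue_hlogAt1_σf {v : List (Let M)} (hv : IsDReg v) :
    HasRegValue (fun y => hlogAt1 (σf π y) v) (Kconst v) := by
  unfold Kconst
  by_cases hmv : ∃ c, mv c ∈ v
  · rw [if_pos hmv]
    exact hasRegValue_of_tendsto (tendsto_hlogAt1_σf hπ hv.1 hv.2 hmv)
  · rw [if_neg hmv]
    push Not at hmv
    refine hasRegValue_of_tendsto (tendsto_const_nhds.congr' (Eventually.of_forall fun y => ?_))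
    exact (hlogAt1_σf_of_noMoving hv hmv y).symm

/-! #### The filtered algebra of multiple zeta values and good expansions -/

/-- `𝒵_{≤ n} = Σ_{w ≤ n} 𝒵_w`. [folklore] -/
abbrev Fil (n : ℕ) : Submodule ℚ ℝ := ⨆ (w : ℕ) (_ : w ≤ n), mzvSpace w

omit [Fintype M] [DecidableEq M] in
/-- Monotonicity of the filtration. [folklore] -/
theorem fil_mono {m n : ℕ} (h : m ≤ n) : Fil m ≤ Fil n :=
  iSup₂_le fun w hw => le_iSup₂ (f := fun (w : ℕ) (_ : w ≤ n) => mzvSpace w) w (hw.trans h)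

omit [Fintype M] [DecidableEq M] in
/-- `𝒵_w ⊆ 𝒵_{≤ n}` for `w ≤ n`. [folklore] -/
theorem mzvSpace_le_fil {w n : ℕ} (h : w ≤ n) : mzvSpace w ≤ Fil n :=
  le_iSup₂ (f := fun (w : ℕ) (_ : w ≤ n) => mzvSpace w) w h

/-- The constants of doubly regular words lie in `𝒵_{≤ |v|}`. [folklore] -/
theorem kconst_mem {v : List (Let M)} (hv : IsDReg v) : Kconst v ∈ Fil v.length := by
  unfold Kconst
  split_ifs with h
  · exact Submodule.zero_mem _
  · push Not at h
    have hconv := (KZ3.isConvWord_iff _).1 (isConvWord_map_κb hv h)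
    have := multipleZeta_ofBinaryWord_mem hconv
    rw [List.length_map] at this
    exact mzvSpace_le_fil le_rfl this

/-- Good expansions of level `n`: the entry at `U` lies in `𝒵_{≤ n - |U|}`. [folklore] -/
def GoodE (n : ℕ) (E : List (Option M) →₀ ℝ) : Prop := ∀ U, E U ∈ Fil (n - U.length)

omit [Fintype M] [DecidableEq M] in
/-- `0` is good. [folklore] -/
theorem goodE_zero (n : ℕ) : GoodE n (0 : List (Option M) →₀ ℝ) := fun _ => Submodule.zero_mem _

omit [Fintype M] [DecidableEq M] in
/-- Good expansions add. [folklore] -/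
theorem GoodE.add {n : ℕ} {E F : List (Option M) →₀ ℝ} (hE : GoodE n E) (hF : GoodE n F) : GoodE n (E + F) :=
  fun U => by rw [Finsupp.add_apply]; exact Submodule.add_mem _ (hE U) (hF U)

omit [Fintype M] in
/-- A single with a good entry is good. [folklore] -/
theorem goodE_single {n : ℕ} (U : List (Option M)) {a : ℝ} (ha : a ∈ Fil (n - U.length)) :
    GoodE n (Finsupp.single U a) := by
  intro V
  by_cases hUV : U = V
  · subst hUV; rwa [Finsupp.single_eq_same]
  · rw [Finsupp.single_apply, if_neg hUV]; exact Submodule.zero_mem _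

omit [Fintype M] [DecidableEq M] in
/-- Finite sums of good expansions are good. [folklore] -/
theorem goodE_finset_sum {ι : Type*} {n : ℕ} (s : Finset ι) {E : ι → List (Option M) →₀ ℝ}
    (h : ∀ i ∈ s, GoodE n (E i)) : GoodE n (∑ i ∈ s, E i) := by
  classical
  induction s using Finset.induction_on with
  | empty => simpa using goodE_zero n
  | insert i s hi IH =>
    rw [Finset.sum_insert hi]
    exact (h i (Finset.mem_insert_self i s)).add (IH fun j hj => h j (Finset.mem_insert_of_mem hj))

omit [Fintype M] in
/-- **The primitive expansion raises the level by one** when the density coefficients are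
rational. [folklore] -/
theorem goodE_primE {n : ℕ} {f : Option M →₀ ℝ} (hf : ∀ ℓ, IsRat (f ℓ)) {E : List (Option M) →₀ ℝ}
    (hE : GoodE n E) : GoodE (n + 1) (primE f E) := by
  classical
  unfold primE
  simp only [Finsupp.sum]
  refine goodE_finset_sum _ fun ℓ _ => goodE_finset_sum _ fun U _ => goodE_single _ ?_
  have hlen : n + 1 - (ℓ :: U).length = n - U.length := by simp
  rw [hlen]
  have hq : IsRat (dsgn ℓ * f ℓ) := by
    refine IsRat.mul ?_ (hf ℓ)
    cases ℓ with
    | none => exact isRat_one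
    | some _ => exact isRat_one.neg
  exact hq.mul_mem_iSup (hE U)

/-! #### Rationality of the pairing tables -/

omit [Fintype M] in
/-- Entries of singles with rational values are rational. [folklore] -/
theorem isRat_single_apply (m ℓ : Option M) {r : ℝ} (hr : IsRat r) : IsRat (Finsupp.single m r ℓ) := by
  by_cases hm : m = ℓ
  · subst hm; rw [Finsupp.single_eq_same]; exact hr
  · rw [Finsupp.single_apply, if_neg hm]; exact isRat_zero

omit [Fintype M] in
/-- All entries of `pairE a a'` are rational. [folklore] -/
theorem isRat_pairE (a a' : Let M) (ℓ : Option M) : IsRat (pairE a a' ℓ) := by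
  have hm1 : IsRat (-1 : ℝ) := isRat_one.neg
  cases a with
  | z =>
    cases a' with
    | z => exact isRat_zero
    | o => exact isRat_zero
    | mv c => exact isRat_single_apply _ _ isRat_one
  | o =>
    cases a' with
    | z => exact isRat_zero
    | o => exact isRat_zero
    | mv c =>
      simp only [pairE, Finsupp.add_apply]
      exact (isRat_single_apply _ _ hm1).add (isRat_single_apply _ _ isRat_one)
  | mv c =>
    cases a' with
    | z => exact isRat_single_apply _ _ hm1
    | o =>
      simp only [pairE, Finsupp.add_apply]
      exact (isRat_single_apply _ _ hm1).add (isRat_single_apply _ _ isRat_one)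
    | mv c' =>
      simp only [pairE]
      split_ifs
      · exact isRat_zero
      · exact isRat_single_apply _ _ hm1

omit [Fintype M] in
/-- All entries of `baseE a` are rational. [folklore] -/
theorem isRat_baseE (a : Let M) (ℓ : Option M) : IsRat (baseE a ℓ) := by
  cases a with
  | z => exact isRat_zero
  | o => exact isRat_zero
  | mv c => exact isRat_single_apply _ _ isRat_one.neg

omit [Fintype M] in
/-- All entries of `end1E a` are rational. [folklore] -/
theorem isRat_end1E (a : Let M) (ℓ : Option M) : IsRat (end1E a ℓ) := by
  cases a with
  | z => exact isRat_zero
  | o => exact isRat_zero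
  | mv c =>
    simp only [end1E, Finsupp.add_apply]
    exact (isRat_single_apply _ _ isRat_one.neg).add (isRat_single_apply _ _ isRat_one)

omit [Fintype M] in
/-- All entries of `inE a u` are rational. [folklore] -/
theorem isRat_inE (a : Let M) (u : List (Let M)) (ℓ : Option M) : IsRat (inE a u ℓ) := by
  cases u with
  | nil => exact isRat_baseE a ℓ
  | cons a' _ => exact isRat_pairE a a' ℓ

/-! #### Goodness of the deletion expansions -/

omit [Fintype M] in
/-- The inner deletion expansions are good. [folklore] -/
theorem goodE_DsumE {n : ℕ} (X : List (Let M) → (List (Option M) →₀ ℝ))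
    (hX : ∀ w : List (Let M), w.length < n → GoodE w.length (X w)) :
    ∀ (u pre : List (Let M)) (c₀ : Let M), pre.length + 1 + u.length = n →
    GoodE n (DsumE X (pre ++ [c₀]) c₀ u) := by
  intro u
  induction u with
  | nil => intro pre c₀ _; exact goodE_zero n
  | cons a u IH =>
    intro pre c₀ hlen
    simp only [DsumE]
    refine GoodE.add ?_ (by simpa using IH (pre ++ [c₀]) a (by simp at hlen ⊢; omega))
    have hlt : (pre ++ [c₀] ++ u).length < n := by simp at hlen ⊢; omega
    have hgood := hX _ hlt
    have hlen' : (pre ++ [c₀] ++ u).length + 1 = n := by simp at hlen ⊢; omega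
    rw [← hlen']
    exact goodE_primE (fun ℓ => by
      rw [Finsupp.sub_apply, sub_eq_add_neg]; exact (isRat_inE a u ℓ).add (isRat_pairE a c₀ ℓ).neg) hgood

omit [Fintype M] in
/-- The top deletion expansion is good. [folklore] -/
theorem goodE_DtopE {n : ℕ} (X : List (Let M) → (List (Option M) →₀ ℝ))
    (hX : ∀ w : List (Let M), w.length < n → GoodE w.length (X w)) {v : List (Let M)} (hlen : v.length = n) :
    GoodE n (DtopE X v) := by
  cases v with
  | nil => exact goodE_zero n
  | cons c u =>
    simp only [DtopE]
    have hlen0 : ([] : List (Let M)).length + 1 + u.length = n := by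
      simp only [List.length_cons] at hlen; simp only [List.length_nil]; omega
    refine GoodE.add ?_ (by simpa using goodE_DsumE X hX u [] c hlen0)
    have hlt : u.length < n := by simp at hlen; omega
    have hlen' : u.length + 1 = n := by simpa using hlen
    rw [← hlen']
    exact goodE_primE (fun ℓ => by
      rw [Finsupp.sub_apply, sub_eq_add_neg]; exact (isRat_inE c u ℓ).add (isRat_end1E c ℓ).neg) (hX u hlt)

/-! #### The empty-word entry and the regularised value of an evaluation -/

omit [Fintype M] [DecidableEq M] in
/-- The primitive expansion has no empty-word entry. [folklore] -/
theorem primE_nil (f : Option M →₀ ℝ) (E : List (Option M) →₀ ℝ) : primE f E [] = 0 := by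
  classical
  unfold primE
  simp only [Finsupp.sum, Finsupp.coe_finsetSum, Finset.sum_apply]
  refine Finset.sum_eq_zero fun ℓ _ => Finset.sum_eq_zero fun U _ => ?_
  rw [Finsupp.single_apply, if_neg (List.cons_ne_nil ℓ U)]

omit [Fintype M] in
/-- The inner deletion expansions have no empty-word entry. [folklore] -/
theorem DsumE_nil_entry (X : List (Let M) → (List (Option M) →₀ ℝ)) :
    ∀ (u pre : List (Let M)) (c₀ : Let M), DsumE X pre c₀ u [] = 0 := by
  intro u
  induction u with
  | nil => intro pre c₀; simp [DsumE]
  | cons a u IH => intro pre c₀; simp only [DsumE, Finsupp.add_apply, primE_nil, IH, add_zero]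

omit [Fintype M] in
/-- The top deletion expansion has no empty-word entry. [folklore] -/
theorem DtopE_nil_entry (X : List (Let M) → (List (Option M) →₀ ℝ)) (v : List (Let M)) : DtopE X v [] = 0 := by
  cases v with
  | nil => simp [DtopE]
  | cons c u => simp only [DtopE, Finsupp.add_apply, primE_nil, DsumE_nil_entry, add_zero]

include hπ in
omit [Fintype M] in
/-- **Regularised value at `y → 0⁺` of an evaluation**: `Reg_{y=0} Σ_U E_U L_U(y) = E_∅`
(`Reg L_U(y) = δ_{U,∅}`, layer VI). [folklore] -/
theorem hasRegValue_evalE (E : List (Option M) →₀ ℝ) : HasRegValue (fun y => evalE π E y) (E []) := by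
  classical
  have hz : τf π none = 0 := rfl
  have hσz := τf_adm hπ
  -- `Reg L_U(y) = δ_{U, ∅}`
  have hone : HasTaylor (fun _ : ℝ => (1 : ℝ)) (fun i => if i = 0 then 1 else 0) :=
    hasTaylor_of_finite 0 (fun i hi => if_neg (by omega)) (Eventually.of_forall fun a => by simp)
  have hU : ∀ U : List (Option M), HasRegValue (fun y => hlogSeries (τf π) none y U) (if U = [] then 1 else 0) := by
    intro U
    have h := hasRegValue_zpow_mul_taylor_mul_hlogSeries hz hσz hone 0 U
    simp only [le_refl, if_true, neg_zero, Int.toNat_zero, Finset.Nat.antidiagonal_zero,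
      Finset.sum_singleton, one_mul, zpow_zero, regCoeff_zero] at h
    exact h
  have hsum := HasRegValue.sum E.support (φ := fun U y => E U * hlogSeries (τf π) none y U)
    (c := fun U => E U * if U = [] then 1 else 0) fun U _ => (hU U).smul (E U)
  have hval : ∑ U ∈ E.support, E U * (if U = [] then (1 : ℝ) else 0) = E [] := by
    simp only [mul_ite, mul_one, mul_zero]
    rw [Finset.sum_ite_eq']
    split_ifs with h
    · rfl
    · have : ¬ E [] ≠ 0 := fun hne => h (Finsupp.mem_support_iff.2 hne)
      push Not at this; exact this.symm
  rw [hval] at hsum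
  exact hsum.congr (Eventually.of_forall fun y => by simp only [evalE, Finsupp.sum])

/-! #### The strengthened induction -/

include hπ hπi in
/-- **Theorem T4 with coefficients.** The expansions of Theorem T4 can be chosen with entries in
the filtered `ℚ`-algebra of multiple zeta values, `(E_v)_U ∈ 𝒵_{≤ |v| - |U|}`, the constant term
being `0` if `v` has a moving letter and `ζ(v)` otherwise. [cite: BrownENS2009, §5.3, §6.3, Thm 6.25 (analogue)] -/
theorem exists_good_expansion : ∀ n : ℕ, ∃ X : List (Let M) → (List (Option M) →₀ ℝ),
    ∀ w : List (Let M), w.length ≤ n →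
      (IsDReg w → ∀ y ∈ Ioo (0 : ℝ) 1, hlogAt1 (σf π y) w = evalE π (X w) y) ∧ (¬IsDReg w → X w = 0) ∧
      GoodE w.length (X w) := by
  classical
  intro n
  induction n with
  | zero =>
    refine ⟨fun w => if w = [] then Finsupp.single [] 1 else 0, fun w hw => ?_⟩
    have hw0 : w = [] := List.length_eq_zero_iff.mp (Nat.le_zero.1 hw)
    subst hw0
    refine ⟨fun _ y hy => ?_, fun h => absurd isDReg_nil h, ?_⟩
    · simp only [if_true, evalE_single]
      rw [hlogSeries_nil (σ := τf π) rfl (τf_adm hπ) hy, mul_one, hlogAt1_nil (σf_adm hπ hy)]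
    · simp only [if_true]
      exact goodE_single _ (isRat_one.mem_iSup _)
  | succ n IH =>
    obtain ⟨X, hX⟩ := IH
    refine ⟨fun w => if w.length ≤ n then X w else
      if IsDReg w then Finsupp.single [] (Kconst w) + DtopE X w else 0, fun w hw => ?_⟩
    by_cases hwn : w.length ≤ n
    · simp only [hwn, if_true]; exact hX w hwn
    · have hwlen : w.length = n + 1 := by omega
      simp only [hwn, if_false]
      have hX' : ∀ w' : List (Let M), w'.length < n + 1 →
          (IsDReg w' → ∀ y ∈ Ioo (0 : ℝ) 1, hlogAt1 (σf π y) w' = evalE π (X w') y) ∧ (¬IsDReg w' → X w' = 0) :=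
        fun w' hw' => ⟨(hX w' (by omega)).1, (hX w' (by omega)).2.1⟩
      have hXg : ∀ w' : List (Let M), w'.length < n + 1 → GoodE w'.length (X w') :=
        fun w' hw' => (hX w' (by omega)).2.2
      refine ⟨fun hdr y hy => ?_, fun hdr => by rw [if_neg hdr], ?_⟩
      · rw [if_pos hdr, evalE_add, evalE_single, hlogSeries_nil (σ := τf π) rfl (τf_adm hπ) hy, mul_one]
        -- `G = L_w(1; σ_y) - evalE (DtopE X w) y` is constant on `(0,1)` ...
        have hG : ∀ y' ∈ Ioo (0 : ℝ) 1, HasDerivAt (fun y => hlogAt1 (σf π y) w - evalE π (DtopE X w) y) 0 y' := by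
          intro y' hy'
          have h1 := hasDerivAt_hlogAt1_σf hπ hπi hdr hy'
          have h2 := hasDerivAt_evalE_DtopE hπ hπi X hX' hdr (le_of_eq hwlen) hy'
          have h := h1.sub h2
          rwa [sub_self] at h
        have hconst : ∀ y₁ ∈ Ioo (0 : ℝ) 1, ∀ y₂ ∈ Ioo (0 : ℝ) 1,
            hlogAt1 (σf π y₁) w - evalE π (DtopE X w) y₁ = hlogAt1 (σf π y₂) w - evalE π (DtopE X w) y₂ :=
          fun y₁ hy₁ y₂ hy₂ => isOpen_Ioo.is_const_of_deriv_eq_zero (𝕜 := ℝ)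
            (f := fun y => hlogAt1 (σf π y) w - evalE π (DtopE X w) y)
            isPreconnected_Ioo (fun y' hy' => (hG y' hy').differentiableAt.differentiableWithinAt)
            (fun y' hy' => (hG y' hy').deriv) hy₁ hy₂
        -- ... and its regularised value at `0⁺` is `Kconst w`
        have hreg : HasRegValue (fun y => hlogAt1 (σf π y) w - evalE π (DtopE X w) y)
            (Kconst w + (-1) * DtopE X w []) :=
          ((hasRegValue_hlogAt1_σf hπ hdr).add ((hasRegValue_evalE hπ (DtopE X w)).smul (-1))).congr
            (Eventually.of_forall fun y => by ring)
        have htend : Tendsto (fun y' => hlogAt1 (σf π y') w - evalE π (DtopE X w) y') (𝓝[>] 0)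
            (𝓝 (hlogAt1 (σf π y) w - evalE π (DtopE X w) y)) := by
          refine tendsto_const_nhds.congr' ?_
          filter_upwards [Ioo_mem_nhdsGT (zero_lt_one' ℝ)] with y' hy'
          exact hconst y hy y' hy'
        have := hreg.eq_of_tendsto htend
        rw [DtopE_nil_entry, mul_zero, add_zero] at this
        linarith
      · rw [hwlen]
        split_ifs with hdr
        · refine (goodE_single [] ?_).add (goodE_DtopE X hXg hwlen)
          simpa [hwlen] using kconst_mem hdr
        · exact goodE_zero _

include hπ hπi in
/-- **Theorem T4 with coefficients**, packaged: for a doubly regular word `v` there is an expansion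
`E` with `(E)_U ∈ 𝒵_{≤ |v|-|U|}` and `L_v(1; σ_y) = Σ_U E_U L_U(y; τ)` on `(0,1)`. [cite: BrownENS2009, §5.3, §6.3] -/
theorem hlogAt1_σf_eq_evalE_good {v : List (Let M)} (hv : IsDReg v) :
    ∃ E : List (Option M) →₀ ℝ, GoodE v.length E ∧ ∀ y ∈ Ioo (0 : ℝ) 1, hlogAt1 (σf π y) v = evalE π E y := by
  obtain ⟨X, hX⟩ := exists_good_expansion hπ hπi v.length
  exact ⟨X v, (hX v le_rfl).2.2, (hX v le_rfl).1 hv⟩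

end Coefficients

end Hyperlog

end Literature.NumberTheory.Transcendental
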